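import Summits.QuantumFields.BalabanUV.Beta.GAN24.CombExitFaceSlotStaircase
import Summits.QuantumFields.BalabanUV.Beta.GAN24.ExchangeESectorStaircase

/-!
# `BalabanUV.Beta.GAN24.CombExchangeESectorStaircase` — binder row G-an2-4 ∕ (CONV-C), W-slot CT-W, the COMB chart (III′), J2_comb step T2: **THE `E ⊗ E` EXCHANGE WORD OF THE
# (UNTRANSPORTED) COMB CUBIC SECTOR `cE • V^c_j`, TABLE-FREE** — leaf-06 g53's `ExchangeESectorStaircase.exchangeWord_sector_eq_stair` with the member replaced: the reduced exchange word
# through `X̃♮_{j+1} = unitK s_f s_m G_{j+1}` is `|box|·c₀σ_{j+1}²·Σ_{x∈box} Σ_a [K_E·(−½Σ'_y ⌊y_μ∕Lc⌋χ_α(y)·E2_{j+1}(y,x)_{αa})]·[K_E·(½Σ'_z Σ_b X̃♮(x,z)_{ab}·Σ'_{s′} E2_{j+1}(z,s′)_{bβ}·⌊s′_ν∕Lc⌋χ_β(s′))]`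
# — the SAME right-hand side as the spine's (every table of Bałaban's AND the transport `𝒯` drop out); the Ward pins, every `d j cΛt cΛ`, all units, any amplitude `cE`, kernel root
# `toSite (ctrOff (d+1) Lc)`

NOT IN PRINT; OUR BOOKKEEPING ([folklore] BY NAME: leaf-06 gen 52's generic `ExchangeWordCellPairing.exchangeWord_eq_cellPairing`, `ExchangeE2E2Channel.faceface_unitS_smul_fst`,
`ExchangeE2E2ChannelTools.faceface_unitS_smul`, my T1 `CombExitFaceSlotStaircase.faceface_e3OfK_eq_stair ∕ _fst`, admissibility of the comb sector table (§0: an2's `locStencil_e3OfK`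
over C `exists_locStencil_transport_ScombOf`, `e3OfK_translate` over C `transport_ScombOf_translate`); G-an2-4 formalisation swarm, leaf prover `b2b-balaban-gan24-formalise-leaf-01`,
gen 87, file T2).  HONEST FRAMING (cell contract, verbatim): «discharging `BetaPertH` makes Bałaban's UV stability UNCONDITIONAL — a real constructive-QFT result; it is NOT the continuum
limit and NOT the Clay problem.»  HONEST DEPENDENCY (verbatim): «continuum YM on T⁴ ⇐ BetaPertH ∧ nine spine estimates (0/9 proved); BetaPertH ⇐ (D1) ∧ (D4) ∧ CAP+tail; G-an2-4 gates
asym, D1 and NE2/3/4.»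

WHAT ([folklore]; `[NeZero Lc]`; 0 `def`, 0 cited facts, 0 `def … : Prop`, 0 sorry): §0 `locStencil_sectorTable`, `sectorTable_translate` (the comb sector table `κ u ↦ cE • V^c_j κ u` is a local,
fine-covariant stencil family); §1 **`exchangeWord_sector_eq_stair`** (same name as leaf-06's, namespace `CombExchangeESectorStaircase`).  Asserts NO value of Bałaban's tables; NEVER
«G-an2-4 closed» as (CONV-C); NOT D1, NOT `BetaPertH`, NOT continuum, NOT Clay.  2026-08-27; no existing file touched.
-/

noncomputable section

open Finset
open scoped BigOperators
open Literature.MathematicalPhysics.QuantumFieldTheory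
open Literature.MathematicalPhysics.QuantumFieldTheory.Balaban1983to89
open Literature.MathematicalPhysics.QuantumFieldTheory.Balaban1983to89.Beta
open ExpKernelCalculus (Site MKer comp shiftK)
open OneStepResolventKernel (Fib LocStencil)
open OneStepKernelFamily (KInvStep vertexOfK)
open AffineAveraging (box toSite)
open AveragingContoursRooted (ctr ctrOff ctrOff_mem_box)
open BalabanStepJetsSucc (E2)
open StepJetData (locStencil_smul)
open Summit.QuantumFields.BalabanUV.Beta.TameKernelCalculus (trK)
open Summit.QuantumFields.BalabanUV.Beta.AxialDressingRooted (coDressKBmAt one_le_of_neZero decays_coDressKBmAt_KInvStep shiftK_coDressKBmAt_KInvStep)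
open Summit.QuantumFields.BalabanUV.Beta.HessKerDressedUnits (unitK unitS)
open Summit.QuantumFields.BalabanUV.Beta.SpineRooted (e3OfK locStencil_e3OfK e3OfK_translate)
open Summit.QuantumFields.BalabanUV.Beta.SymSecondOrderTablesAn1 (symTablesAn1S2)
open Summit.QuantumFields.BalabanUV.Beta.CombChartStepJets (ScombOf)
open Summit.QuantumFields.BalabanUV.Beta.SymCorrectorKernel (psiKS)
open Summit.QuantumFields.BalabanUV.Beta.SymCorrectorFace (slotPsiS)
open Summit.QuantumFields.BalabanUV.Beta.GAN24.CombTransportedBorder (pos_Lc)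
open Summit.QuantumFields.BalabanUV.Beta.GAN24.CombVHEWordsZeroStep (exists_locStencil_transport_ScombOf transport_ScombOf_translate)
open Summit.QuantumFields.BalabanUV.Beta.GAN24.ExchangeE2E2ChannelTools (faceface_unitS_smul)
open Summit.QuantumFields.BalabanUV.Beta.GAN24.ExchangeWordCellPairing (exchangeWord_eq_cellPairing)
open Summit.QuantumFields.BalabanUV.Beta.GAN24.ExchangeE2E2Channel (faceface_unitS_smul_fst)
open Summit.QuantumFields.BalabanUV.Beta.GAN24.CombExitFaceSlotStaircase (faceface_e3OfK_eq_stair faceface_e3OfK_eq_stair_fst)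

namespace Summit.QuantumFields.BalabanUV.Beta.GAN24.CombExchangeESectorStaircase

variable {d : ℕ} {Lc : ℕ} [NeZero Lc]

/-! ## §0 The comb sector table is admissible -/

/-- [folklore] The comb sector table `cE • V^c_j` is a local stencil family at a positive rate (C `exists_locStencil_transport_ScombOf`, an2 `locStencil_e3OfK`, `locStencil_smul`). -/
theorem locStencil_sectorTable (cΛt cE cΛ : ℝ) (j : ℕ) :
    ∃ Cs δs : ℝ, 0 < δs ∧ LocStencil (fun κ u => cE • e3OfK Lc (coDressKBmAt (toSite (ctrOff (d + 1) Lc)) Lc (KInvStep (d := d) Lc j))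
        (fun κ u => comp (comp (trK (psiKS (ctrOff (d + 1) Lc) Lc)) (slotPsiS (ctrOff (d + 1) Lc) Lc (ScombOf (symTablesAn1S2 d Lc cΛt) ((Lc : ℝ) ^ (d + 1)) (-((Lc : ℝ) ^ (d + 1) * (1 / 2) * (Lc : ℝ) ^ (d + 1))) cΛ j) κ u)) (psiKS (ctrOff (d + 1) Lc) Lc)) κ u) Cs δs := by
  have hLc : 1 ≤ Lc := one_le_of_neZero Lc
  obtain ⟨CM, δM, hδM, hM⟩ := exists_locStencil_transport_ScombOf (d := d) (Lc := Lc) cΛt ((Lc : ℝ) ^ (d + 1)) (-((Lc : ℝ) ^ (d + 1) * (1 / 2) * (Lc : ℝ) ^ (d + 1))) cΛ j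
  obtain ⟨C, δ, hδ, hV⟩ := locStencil_e3OfK (N := Lc) hLc (decays_coDressKBmAt_KInvStep (d := d) (ctrOff_mem_box (pos_Lc (Lc := Lc))) j) hM hδM
  exact ⟨_, δ, hδ, locStencil_smul cE hV⟩

/-- [folklore] The comb sector table is fine-translation covariant in its slot (an2's `e3OfK_translate` over C `transport_ScombOf_translate`; kernel `shiftK_coDressKBmAt_KInvStep`). -/
theorem sectorTable_translate (cΛt cE cΛ : ℝ) (j : ℕ) (κ : Fin (d + 1)) (u v : Fin (d + 1) → ℤ) :
    (fun κ u => cE • e3OfK Lc (coDressKBmAt (toSite (ctrOff (d + 1) Lc)) Lc (KInvStep (d := d) Lc j))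
        (fun κ u => comp (comp (trK (psiKS (ctrOff (d + 1) Lc) Lc)) (slotPsiS (ctrOff (d + 1) Lc) Lc (ScombOf (symTablesAn1S2 d Lc cΛt) ((Lc : ℝ) ^ (d + 1)) (-((Lc : ℝ) ^ (d + 1) * (1 / 2) * (Lc : ℝ) ^ (d + 1))) cΛ j) κ u)) (psiKS (ctrOff (d + 1) Lc) Lc)) κ u) κ (u + v) =
      shiftK (-v) ((fun κ u => cE • e3OfK Lc (coDressKBmAt (toSite (ctrOff (d + 1) Lc)) Lc (KInvStep (d := d) Lc j))
        (fun κ u => comp (comp (trK (psiKS (ctrOff (d + 1) Lc) Lc)) (slotPsiS (ctrOff (d + 1) Lc) Lc (ScombOf (symTablesAn1S2 d Lc cΛt) ((Lc : ℝ) ^ (d + 1)) (-((Lc : ℝ) ^ (d + 1) * (1 / 2) * (Lc : ℝ) ^ (d + 1))) cΛ j) κ u)) (psiKS (ctrOff (d + 1) Lc) Lc)) κ u) κ u) := by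
  have h := e3OfK_translate (N := Lc) (shiftK_coDressKBmAt_KInvStep (d := d) (toSite (ctrOff (d + 1) Lc)) j)
    (S := (fun κ u => comp (comp (trK (psiKS (ctrOff (d + 1) Lc) Lc)) (slotPsiS (ctrOff (d + 1) Lc) Lc (ScombOf (symTablesAn1S2 d Lc cΛt) ((Lc : ℝ) ^ (d + 1)) (-((Lc : ℝ) ^ (d + 1) * (1 / 2) * (Lc : ℝ) ^ (d + 1))) cΛ j) κ u)) (psiKS (ctrOff (d + 1) Lc) Lc)))
    (fun κ u t => transport_ScombOf_translate (d := d) (Lc := Lc) cΛt ((Lc : ℝ) ^ (d + 1)) (-((Lc : ℝ) ^ (d + 1) * (1 / 2) * (Lc : ℝ) ^ (d + 1))) cΛ j κ u t) κ u v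
  funext x z a b
  simp only [Pi.smul_apply, smul_eq_mul, shiftK, h]

/-! ## §1 The E-sector EE word, table-free -/

/-- [folklore] **THE E-SECTOR EE WORD OF ROW (C) AT LEVEL `j+1`, TABLE-FREE** (every `j`, in-block root, all units, amplitude `cE`, any `cΛ`): the reduced EE word
(vertices and middle kernel `X̃♮ = unitK sf sm G_{j+1}`, table `S_E = cE • V_j`)
`= |box|·c₀σ_{j+1}²·Σ_{x∈box} Σ_a [K_E·(−½·Σ'_y (⌊y_μ∕Lc⌋·χ_α(y))·E2_{j+1}(y,x)_{αa})] · [K_E·(½·Σ'_z Σ_b X̃♮(x,z)_{ab}·Σ'_{s′} E2_{j+1}(z,s′)_{bβ}·(⌊s′_ν∕Lc⌋·χ_β(s′)))]`. -/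
theorem exchangeWord_sector_eq_stair (cΛt sf sm cE cΛ : ℝ) (j : ℕ) (μ α ν β : Fin (d + 1)) :
    ∑ u ∈ box (d + 1) Lc, ∑' y₁ : Site (d + 1), ∑ a : Fin (d + 1),
        (∑' y : Site (d + 1), (if y α % (Lc : ℤ) = (Lc : ℤ) - 1 then (1 : ℝ) else 0) *
          vertexOfK (unitK sf sm (coDressKBmAt (toSite (ctrOff (d + 1) Lc)) Lc (KInvStep (d := d) Lc (j + 1)))) Lc
            (unitS sf sm (fun κ u => cE • e3OfK Lc (coDressKBmAt (toSite (ctrOff (d + 1) Lc)) Lc (KInvStep (d := d) Lc j))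
              (fun κ u => comp (comp (trK (psiKS (ctrOff (d + 1) Lc) Lc)) (slotPsiS (ctrOff (d + 1) Lc) Lc (ScombOf (symTablesAn1S2 d Lc cΛt) ((Lc : ℝ) ^ (d + 1)) (-((Lc : ℝ) ^ (d + 1) * (1 / 2) * (Lc : ℝ) ^ (d + 1))) cΛ j) κ u)) (psiKS (ctrOff (d + 1) Lc) Lc)) κ u)) μ (toSite u) y y₁ (Sum.inl α) (Sum.inl a)) *
        (∑' z : Site (d + 1), ∑ b : Fin (d + 1), unitK sf sm (coDressKBmAt (toSite (ctrOff (d + 1) Lc)) Lc (KInvStep (d := d) Lc (j + 1))) y₁ z (Sum.inl a) (Sum.inl b) *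
          (∑' u' : Site (d + 1), ∑' w : Site (d + 1), (if w β % (Lc : ℤ) = (Lc : ℤ) - 1 then (1 : ℝ) else 0) *
            vertexOfK (unitK sf sm (coDressKBmAt (toSite (ctrOff (d + 1) Lc)) Lc (KInvStep (d := d) Lc (j + 1)))) Lc
              (unitS sf sm (fun κ u => cE • e3OfK Lc (coDressKBmAt (toSite (ctrOff (d + 1) Lc)) Lc (KInvStep (d := d) Lc j))
                (fun κ u => comp (comp (trK (psiKS (ctrOff (d + 1) Lc) Lc)) (slotPsiS (ctrOff (d + 1) Lc) Lc (ScombOf (symTablesAn1S2 d Lc cΛt) ((Lc : ℝ) ^ (d + 1)) (-((Lc : ℝ) ^ (d + 1) * (1 / 2) * (Lc : ℝ) ^ (d + 1))) cΛ j) κ u)) (psiKS (ctrOff (d + 1) Lc) Lc)) κ u)) ν u' z w (Sum.inl b) (Sum.inl β))) =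
      ((box (d + 1) Lc).card : ℝ) * (((Lc : ℝ) * (sm * sf)) * ((((Lc ^ (j + 1 + 1) : ℕ) : ℝ)) ^ (d + 1 + 1))⁻¹) ^ 2 *
        ∑ x ∈ box (d + 1) Lc, ∑ a : Fin (d + 1),
          (((sf * sm)⁻¹ * (sf⁻¹ * sf⁻¹) * cE) *
            (-(1 / 2 : ℝ) * ∑' y : Site (d + 1), ((((y μ / (Lc : ℤ) : ℤ) : ℝ)) * (if y α % (Lc : ℤ) = (Lc : ℤ) - 1 then (1 : ℝ) else 0)) *
              E2 d Lc (j + 1) y (toSite x) (Sum.inl α) (Sum.inl a))) *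
          (((sf * sm)⁻¹ * (sf⁻¹ * sf⁻¹) * cE) *
            ((1 / 2 : ℝ) * ∑' z : Site (d + 1), ∑ b : Fin (d + 1), unitK sf sm (coDressKBmAt (toSite (ctrOff (d + 1) Lc)) Lc (KInvStep (d := d) Lc (j + 1))) (toSite x) z (Sum.inl a) (Sum.inl b) *
              ∑' s' : Site (d + 1), E2 d Lc (j + 1) z s' (Sum.inl b) (Sum.inl β) *
                ((((s' ν / (Lc : ℤ) : ℤ) : ℝ)) * (if s' β % (Lc : ℤ) = (Lc : ℤ) - 1 then (1 : ℝ) else 0)))) := by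
  have hr : ctrOff (d + 1) Lc ∈ box (d + 1) Lc := ctrOff_mem_box (pos_Lc (Lc := Lc))
  obtain ⟨Cs, δs, hδs, hS⟩ := locStencil_sectorTable (d := d) (Lc := Lc) cΛt cE cΛ j
  rw [exchangeWord_eq_cellPairing (μ := μ) (α := α) (ν := ν) (β := β) hr hS hδs (fun κ u v => sectorTable_translate (d := d) (Lc := Lc) cΛt cE cΛ j κ u v) sf sm (j + 1)]
  refine congrArg (fun t : ℝ => ((box (d + 1) Lc).card : ℝ) * (((Lc : ℝ) * (sm * sf)) * ((((Lc ^ (j + 1 + 1) : ℕ) : ℝ)) ^ (d + 1 + 1))⁻¹) ^ 2 * t)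
    (Finset.sum_congr rfl fun x _ => Finset.sum_congr rfl fun a _ => ?_)
  -- left current: units out, then the staircase letter (first-leg form)
  have hL : (∑' y : Site (d + 1), (if y α % (Lc : ℤ) = (Lc : ℤ) - 1 then (1 : ℝ) else 0) *
      ∑' t : Site (d + 1), (if t μ % (Lc : ℤ) = (Lc : ℤ) - 1 then
        unitS sf sm (fun κ u => cE • e3OfK Lc (coDressKBmAt (toSite (ctrOff (d + 1) Lc)) Lc (KInvStep (d := d) Lc j))
          (fun κ u => comp (comp (trK (psiKS (ctrOff (d + 1) Lc) Lc)) (slotPsiS (ctrOff (d + 1) Lc) Lc (ScombOf (symTablesAn1S2 d Lc cΛt) ((Lc : ℝ) ^ (d + 1)) (-((Lc : ℝ) ^ (d + 1) * (1 / 2) * (Lc : ℝ) ^ (d + 1))) cΛ j) κ u)) (psiKS (ctrOff (d + 1) Lc) Lc)) κ u) μ t y (toSite x) (Sum.inl α) (Sum.inl a)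
        else 0)) =
      ((sf * sm)⁻¹ * (sf⁻¹ * sf⁻¹) * cE) *
        (-(1 / 2 : ℝ) * ∑' y : Site (d + 1), ((((y μ / (Lc : ℤ) : ℤ) : ℝ)) * (if y α % (Lc : ℤ) = (Lc : ℤ) - 1 then (1 : ℝ) else 0)) *
          E2 d Lc (j + 1) y (toSite x) (Sum.inl α) (Sum.inl a)) := by
    rw [faceface_unitS_smul_fst sf sm cE _ μ (fun t : Site (d + 1) => t μ % (Lc : ℤ) = (Lc : ℤ) - 1)
      (fun y : Site (d + 1) => (if y α % (Lc : ℤ) = (Lc : ℤ) - 1 then (1 : ℝ) else 0)) (toSite x) α a, faceface_e3OfK_eq_stair_fst cΛt cΛ j μ α (toSite x) a]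
  -- right current: pointwise in `(z, b)`, units out, then the staircase letter
  have hR : ∀ (z : Site (d + 1)) (b : Fin (d + 1)), (∑' w : Site (d + 1), (if w β % (Lc : ℤ) = (Lc : ℤ) - 1 then (1 : ℝ) else 0) *
      ∑' t : Site (d + 1), (if t ν % (Lc : ℤ) = (Lc : ℤ) - 1 then
        unitS sf sm (fun κ u => cE • e3OfK Lc (coDressKBmAt (toSite (ctrOff (d + 1) Lc)) Lc (KInvStep (d := d) Lc j))
          (fun κ u => comp (comp (trK (psiKS (ctrOff (d + 1) Lc) Lc)) (slotPsiS (ctrOff (d + 1) Lc) Lc (ScombOf (symTablesAn1S2 d Lc cΛt) ((Lc : ℝ) ^ (d + 1)) (-((Lc : ℝ) ^ (d + 1) * (1 / 2) * (Lc : ℝ) ^ (d + 1))) cΛ j) κ u)) (psiKS (ctrOff (d + 1) Lc) Lc)) κ u) ν t z w (Sum.inl b) (Sum.inl β)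
        else 0)) =
      ((sf * sm)⁻¹ * (sf⁻¹ * sf⁻¹) * cE) *
        ((1 / 2 : ℝ) * ∑' s' : Site (d + 1), E2 d Lc (j + 1) z s' (Sum.inl b) (Sum.inl β) *
          ((((s' ν / (Lc : ℤ) : ℤ) : ℝ)) * (if s' β % (Lc : ℤ) = (Lc : ℤ) - 1 then (1 : ℝ) else 0))) := by
    intro z b
    rw [faceface_unitS_smul sf sm cE _ ν (fun t : Site (d + 1) => t ν % (Lc : ℤ) = (Lc : ℤ) - 1)
      (fun w : Site (d + 1) => (if w β % (Lc : ℤ) = (Lc : ℤ) - 1 then (1 : ℝ) else 0)) z b β, faceface_e3OfK_eq_stair cΛt cΛ j ν β z b]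
  have hR' : (∑' z : Site (d + 1), ∑ b : Fin (d + 1), unitK sf sm (coDressKBmAt (toSite (ctrOff (d + 1) Lc)) Lc (KInvStep (d := d) Lc (j + 1))) (toSite x) z (Sum.inl a) (Sum.inl b) *
      (∑' w : Site (d + 1), (if w β % (Lc : ℤ) = (Lc : ℤ) - 1 then (1 : ℝ) else 0) *
        ∑' t : Site (d + 1), (if t ν % (Lc : ℤ) = (Lc : ℤ) - 1 then
          unitS sf sm (fun κ u => cE • e3OfK Lc (coDressKBmAt (toSite (ctrOff (d + 1) Lc)) Lc (KInvStep (d := d) Lc j))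
            (fun κ u => comp (comp (trK (psiKS (ctrOff (d + 1) Lc) Lc)) (slotPsiS (ctrOff (d + 1) Lc) Lc (ScombOf (symTablesAn1S2 d Lc cΛt) ((Lc : ℝ) ^ (d + 1)) (-((Lc : ℝ) ^ (d + 1) * (1 / 2) * (Lc : ℝ) ^ (d + 1))) cΛ j) κ u)) (psiKS (ctrOff (d + 1) Lc) Lc)) κ u) ν t z w (Sum.inl b) (Sum.inl β)
          else 0))) =
      ((sf * sm)⁻¹ * (sf⁻¹ * sf⁻¹) * cE) *
        ((1 / 2 : ℝ) * ∑' z : Site (d + 1), ∑ b : Fin (d + 1), unitK sf sm (coDressKBmAt (toSite (ctrOff (d + 1) Lc)) Lc (KInvStep (d := d) Lc (j + 1))) (toSite x) z (Sum.inl a) (Sum.inl b) *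
          ∑' s' : Site (d + 1), E2 d Lc (j + 1) z s' (Sum.inl b) (Sum.inl β) *
            ((((s' ν / (Lc : ℤ) : ℤ) : ℝ)) * (if s' β % (Lc : ℤ) = (Lc : ℤ) - 1 then (1 : ℝ) else 0))) := by
    rw [← mul_assoc, ← tsum_mul_left]
    refine tsum_congr fun z => ?_
    rw [Finset.mul_sum]
    refine Finset.sum_congr rfl fun b _ => ?_
    rw [hR z b]
    ring
  rw [hL, hR']

end Summit.QuantumFields.BalabanUV.Beta.GAN24.CombExchangeESectorStaircase

end
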